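/-
Origin: expansion seat `planner-pub-hodgecm-toy2-g7-0`, handover #7 HANDOVER 2026-08-18T13:45:07Z (l.4007) md5 2b450270; tree-only imports (packager row: handed in STATUS without a t30 kit row; RUN 30 addendum) (`HOME/pub-hodgecm-toy2-g7/lean/Toy2g7/RealisedRows.lean`, md5 2b450270, 228 lines);
landed by the gen-8 packager in gate run 30 as `HodgeCM/Model/Toy/RealisedRows.lean` (verbatim).
-/
/-
Copyright: pub-hodgecm formalisation cell (harness21, 2026). New file (not vendored).
Origin: HOME/pub-hodgecm-toy2-g7/lean/Toy2g7/RealisedRows.lean — session planner-pub-hodgecm-toy2-g7-0 (unit pub-hodgecm-toy2-g7,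
CONSISTENCY seat 2, part (6a)(ii), generation 7).  WIP module `Toy2g7.RealisedRows`; intended final place
`HodgeCM/Model/Toy/RealisedRows.lean` (module `HodgeCM.Model.Toy.RealisedRows`; kind L5 consistency / non-vacuity layer).
Imports are FINAL package names (all in the tree after gate run 29); nothing to rewrite.
-/
import Mathlib
import Summits.HodgeConjecture.HodgeCM.Model.Inhabited
import Summits.HodgeConjecture.HodgeCM.Model.ConjTwist_2
import Summits.HodgeConjecture.HodgeCM.Model.Toy.ToyConjTwist
import Summits.HodgeConjecture.HodgeCM.Model.Toy.ToyCupScale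
import Summits.HodgeConjecture.HodgeCM.Model.ToyG2.ThetaModel3
import Summits.HodgeConjecture.HodgeCM.Model.ToyG2.DescentFactsAll3
import Summits.HodgeConjecture.HodgeCM.StubTree.Qw8NoN3

/-!
# N2 and F5 are independent of the other binders of `COR_CM_of_descentFactsB₄` — WITH the realisation

Census of the binders of
`HodgeCM.Assembly.COR_CM_of_descentFactsB₄ (U) (M : U.ModelAxioms) (hR : U.RealisationExistsFace)
  (hN1 : U.Fact_cupExterior) (hN2 : U.Fact_cup_hodge) (h4 : U.Fact_cupAlg) (h5 : U.Fact_cupAssoc)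
  (hu : U.Fact_unitH0) (hb : U.Fact_gysinDescentB) (hd : U.Fact_dimProd) : U.HC_CM`.

The generation-6 independence witnesses for N2 (`Toy.twistModel = toyModel.conjTwist twistDeg`,
`HodgeCM.Model.Toy.ToyConjTwist`) and F5 (`Toy.cupModel = toyModel.scaleCup`, `HodgeCM.Model.Toy.ToyCupScale`) live on the
generation-1 toy model, where `RealisationExistsFace` FAILS.  This file runs the same two generic universe transforms on the
generation-2 universe `toyUniverse₃ 1 4` (`HodgeCM.Model.ToyG2.*`), which HAS the realisation
(`ThetaUiso.realisationExistsFace₃`) and satisfies all ten binders (`toyUniverse₃_descentFactsB₄_all`):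

* `Universe.ScaleCup.realisationExistsFace` — theta realisations transfer to `U.scaleCup` (they live in degrees `1, 2`;
  only `cup 2 3` is rescaled);
* `Universe.exists_coh_ne_zero_of_le` — in a model of M + N1, `H^k(A_Φ, ℚ) ≠ 0` for `0 < k ≤ [F:ℚ]` (a weight line);
* **`twistUniverse₃_profile`**: `(toyUniverse₃ 1 4).conjTwist twistDeg` satisfies `ModelAxioms`, `RealisationExistsFace`,
  N1, N3, N4, F4, F5, `Fact_dimProd`, F-H0, F7d-B and `HC_CM`, and REFUTES N2 `Fact_cup_hodge`;
* **`cupUniverse₃_profile`**: `(toyUniverse₃ 1 4).scaleCup` satisfies `ModelAxioms`, `RealisationExistsFace`, N1, N2, N3,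
  N4, F4, `Fact_dimProd`, F-H0, F7d-B and `HC_CM`, and REFUTES F5 `Fact_cupAssoc`;
* the census rows **`cup_hodge_independent_realised`** / **`cupAssoc_independent_realised`**: N2 (resp. F5) is NOT
  derivable from the other nine binders of `COR_CM_of_descentFactsB₄` — realisation included — and both truth values
  occur among models of those nine (`toyUniverse₃ 1 4` itself for the positive side).

READING.  These are INDEPENDENCE rows (the binder is not implied by the others); they are not "necessity for the
conclusion" rows: both transforms preserve `HC_CM` (`ConjTwist.hc_cm_iff`, `ScaleCup.hc_cm_iff`), and no transform that
keeps the Hodge CLASSES can make `HC_CM` fail.  A statement about the hypothesis list of the package in a toy model; it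
says nothing about complex projective varieties.  All proofs kernel-checked; nothing is cited, posited or hypothesised.
-/

noncomputable section

namespace HodgeCM

open Literature.AlgebraicGeometry.Motives (CMType)
open scoped TensorProduct

namespace Universe

variable {U : Universe}

/-! ## 1. Nonzero rational classes on a CM atom (models of M + N1) -/

/-- In a model of M + N1: `H^k(A_Φ, ℚ) ≠ 0` for `0 < k ≤ [F:ℚ]` (the weight line of any weight of size `k`). -/
theorem exists_coh_ne_zero_of_le (M : U.ModelAxioms) (hN1 : U.Fact_cupExterior) {F : CMField} {k : ℕ} (hk : 0 < k)
    (hkF : k ≤ Module.finrank ℚ F) (Θ : Fin (0 + 1) → CMType F) :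
    ∃ v : U.Coh (U.cmProd F Θ) k, v ≠ 0 := by
  have hcard : k ≤ (Finset.univ : Finset ((F : Type) →+* ℂ)).card := by
    rw [Finset.card_univ, NumberField.Embeddings.card]; exact hkF
  obtain ⟨T, -, hT⟩ := Finset.exists_subset_card_eq hcard
  have h1 : Module.finrank ℂ (U.weightSpace F Θ (fun _ => T) k) = 1 := by
    rw [finrank_weightSpace M hN1 hk, if_pos]
    simp [hT]
  by_contra hall
  have hall' : ∀ v : U.Coh (U.cmProd F Θ) k, v = 0 := fun v => Classical.byContradiction fun hv => hall ⟨v, hv⟩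
  have hz : ∀ z : U.CohC (U.cmProd F Θ) k, z = 0 := fun z => by
    induction z using TensorProduct.induction_on with
    | zero => rfl
    | tmul c v => rw [hall' v, TensorProduct.tmul_zero]
    | add x y hx hy => rw [hx, hy, add_zero]
  have hpos : 0 < Module.finrank ℂ (U.weightSpace F Θ (fun _ => T) k) := by rw [h1]; exact Nat.one_pos
  obtain ⟨w, hw⟩ := Module.finrank_pos_iff_exists_ne_zero.mp hpos
  exact hw (Subtype.ext (hz _))

/-- … hence `H^k(A_Φ, ℚ)` is a nontrivial module for `0 < k ≤ [F:ℚ]`. -/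
theorem exists_nontrivial_coh_cmProd (M : U.ModelAxioms) (hN1 : U.Fact_cupExterior) {F : CMField} {k : ℕ} (hk : 0 < k)
    (hkF : k ≤ Module.finrank ℚ F) (Φ : CMType F) :
    ∃ (F' : CMField) (n : ℕ) (Θ : Fin (n + 1) → CMType F'), Nontrivial (U.Coh (U.cmProd F' Θ) k) := by
  obtain ⟨v, hv⟩ := exists_coh_ne_zero_of_le M hN1 hk hkF (fun _ : Fin (0 + 1) => Φ)
  exact ⟨F, 0, fun _ => Φ, nontrivial_of_ne v 0 hv⟩

/-! ## 2. Theta realisations transfer to `U.scaleCup` -/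

namespace ScaleCup

set_option smartUnfolding false in
/-- Theta realisations live in degrees `1, 2` (`cup 1 1`, `cup 2 2`): they transfer to `U.scaleCup` verbatim. -/
theorem realisationExistsFace (h : U.RealisationExistsFace) : U.scaleCup.RealisationExistsFace := by
  intro F hG h6 f ι₁ hf V
  obtain ⟨r⟩ := h F hG h6 f ι₁ hf V
  exact ⟨{ r with }⟩

end ScaleCup

end Universe

/-! ## 3. The two realised rows -/

namespace ToyG2

open Universe Toy

/-- `toyUniverse₃ 1 4` with `H^{3m}` (`m ≥ 1`) replaced by its complex conjugate Hodge structure. -/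
abbrev twistUniverse₃ : Universe := (toyUniverse₃ 1 4).conjTwist twistDeg

/-- `toyUniverse₃ 1 4` with `cup 2 3` doubled. -/
abbrev cupUniverse₃ : Universe := (toyUniverse₃ 1 4).scaleCup

/-- **Profile of the twisted universe**: everything but N2 holds (realisation included), N2 fails. -/
theorem twistUniverse₃_profile :
    twistUniverse₃.ModelAxioms ∧ twistUniverse₃.RealisationExistsFace ∧ twistUniverse₃.Fact_cupExterior ∧
      twistUniverse₃.Fact_pull_H0 ∧ twistUniverse₃.Fact_hodge_F0 ∧ twistUniverse₃.Fact_cupAlg ∧ twistUniverse₃.Fact_cupAssoc ∧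
      twistUniverse₃.Fact_dimProd ∧ twistUniverse₃.Fact_unitH0 ∧ twistUniverse₃.Fact_gysinDescentB ∧ twistUniverse₃.HC_CM ∧
      ¬ twistUniverse₃.Fact_cup_hodge := by
  have M : (toyUniverse₃ 1 4).ModelAxioms := toyUniverse₃_modelAxioms_all 1 4
  have hR : (toyUniverse₃ 1 4).RealisationExistsFace := ThetaUiso.realisationExistsFace₃ 1 4 le_rfl (by norm_num)
  have hN1 : (toyUniverse₃ 1 4).Fact_cupExterior := fact3_cupExterior exteriorHodgeData traceSys (gplOf 1 4)
  have hN2 : (toyUniverse₃ 1 4).Fact_cup_hodge := fact3_cup_hodge traceSys (gplOf 1 4)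
  have hN3 : (toyUniverse₃ 1 4).Fact_pull_H0 := fact3_pull_H0 exteriorHodgeData traceSys (gplOf 1 4)
  have hN4 : (toyUniverse₃ 1 4).Fact_hodge_F0 := fact3_hodge_F0 traceSys (gplOf 1 4)
  have h4 : (toyUniverse₃ 1 4).Fact_cupAlg := fact3_cupAlg traceSys (gplOf 1 4)
  have h5 : (toyUniverse₃ 1 4).Fact_cupAssoc := fact3_cupAssoc exteriorHodgeData traceSys (gplOf 1 4)
  have hd : (toyUniverse₃ 1 4).Fact_dimProd := fact3_dimProd exteriorHodgeData traceSys (gplOf 1 4)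
  have hu : (toyUniverse₃ 1 4).Fact_unitH0 := fact3_unitH0 exteriorHodgeData traceSys (gplOf 1 4)
  have hb : (toyUniverse₃ 1 4).Fact_gysinDescentB := fact3_gysinDescentB traceSys (gplOf 1 4) M
  have hHC : (toyUniverse₃ 1 4).HC_CM := toyUniverse₃_hcCM_by_descentB₄_all
  have h3 := exists_nontrivial_coh_cmProd M hN1 (k := 3) (by norm_num) (by rw [cyclo7_finrank]; norm_num)
    (HodgeCM.stdCMType cyclo7)
  exact ⟨ConjTwist.modelAxioms M degTwist_twistDeg_double, ConjTwist.realisationExistsFace hR,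
    ConjTwist.fact_cupExterior_iff.mpr hN1, ConjTwist.fact_pull_H0_iff.mpr hN3, ConjTwist.fact_hodge_F0_iff.mpr hN4,
    ConjTwist.fact_cupAlg_iff.mpr h4, ConjTwist.fact_cupAssoc_iff.mpr h5, ConjTwist.fact_dimProd_iff.mpr hd,
    ConjTwist.fact_unitH0_iff.mpr hu, ConjTwist.fact_gysinDescentB_iff.mpr hb, ConjTwist.hc_cm_iff.mpr hHC,
    ConjTwist.not_fact_cup_hodge degTwist_twistDeg_three hN1 hN2 hN4 h3⟩

/-- **Profile of the cup-rescaled universe**: everything but F5 holds (realisation included), F5 fails. -/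
theorem cupUniverse₃_profile :
    cupUniverse₃.ModelAxioms ∧ cupUniverse₃.RealisationExistsFace ∧ cupUniverse₃.Fact_cupExterior ∧
      cupUniverse₃.Fact_cup_hodge ∧ cupUniverse₃.Fact_pull_H0 ∧ cupUniverse₃.Fact_hodge_F0 ∧ cupUniverse₃.Fact_cupAlg ∧
      cupUniverse₃.Fact_dimProd ∧ cupUniverse₃.Fact_unitH0 ∧ cupUniverse₃.Fact_gysinDescentB ∧ cupUniverse₃.HC_CM ∧
      ¬ cupUniverse₃.Fact_cupAssoc := by
  have M : (toyUniverse₃ 1 4).ModelAxioms := toyUniverse₃_modelAxioms_all 1 4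
  have hR : (toyUniverse₃ 1 4).RealisationExistsFace := ThetaUiso.realisationExistsFace₃ 1 4 le_rfl (by norm_num)
  have hN1 : (toyUniverse₃ 1 4).Fact_cupExterior := fact3_cupExterior exteriorHodgeData traceSys (gplOf 1 4)
  have hN2 : (toyUniverse₃ 1 4).Fact_cup_hodge := fact3_cup_hodge traceSys (gplOf 1 4)
  have hN3 : (toyUniverse₃ 1 4).Fact_pull_H0 := fact3_pull_H0 exteriorHodgeData traceSys (gplOf 1 4)
  have hN4 : (toyUniverse₃ 1 4).Fact_hodge_F0 := fact3_hodge_F0 traceSys (gplOf 1 4)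
  have h4 : (toyUniverse₃ 1 4).Fact_cupAlg := fact3_cupAlg traceSys (gplOf 1 4)
  have h5 : (toyUniverse₃ 1 4).Fact_cupAssoc := fact3_cupAssoc exteriorHodgeData traceSys (gplOf 1 4)
  have hd : (toyUniverse₃ 1 4).Fact_dimProd := fact3_dimProd exteriorHodgeData traceSys (gplOf 1 4)
  have hu : (toyUniverse₃ 1 4).Fact_unitH0 := fact3_unitH0 exteriorHodgeData traceSys (gplOf 1 4)
  have hb : (toyUniverse₃ 1 4).Fact_gysinDescentB := fact3_gysinDescentB traceSys (gplOf 1 4) M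
  have hHC : (toyUniverse₃ 1 4).HC_CM := toyUniverse₃_hcCM_by_descentB₄_all
  have h6 := exists_nontrivial_coh_cmProd M hN1 (k := 6) (by norm_num) (by rw [cyclo7_finrank])
    (HodgeCM.stdCMType cyclo7)
  exact ⟨ScaleCup.modelAxioms M, ScaleCup.realisationExistsFace hR, ScaleCup.fact_cupExterior_iff.mpr hN1,
    ScaleCup.cup_hodge hN2, ScaleCup.fact_pull_H0_iff.mpr hN3, ScaleCup.fact_hodge_F0_iff.mpr hN4, ScaleCup.cupAlg h4,
    ScaleCup.fact_dimProd_iff.mpr hd, ScaleCup.unitH0 hu, ScaleCup.gysinDescentB hb, ScaleCup.hc_cm_iff.mpr hHC,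
    ScaleCup.not_fact_cupAssoc h5 (exists_cup_triple_ne_zero hN1 h5 h6)⟩

/-- **Census row N2 (with the realisation)**: N2 `Fact_cup_hodge` is NOT derivable from the other nine binders of
`COR_CM_of_descentFactsB₄` — there is a universe satisfying `ModelAxioms`, `RealisationExistsFace`, N1, F4, F5,
`Fact_dimProd`, F-H0, F7d-B (and N3, N4, `HC_CM`) in which N2 fails. -/
theorem exists_realised_all_but_cup_hodge :
    ∃ U : Universe, U.ModelAxioms ∧ U.RealisationExistsFace ∧ U.Fact_cupExterior ∧ U.Fact_pull_H0 ∧ U.Fact_hodge_F0 ∧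
      U.Fact_cupAlg ∧ U.Fact_cupAssoc ∧ U.Fact_dimProd ∧ U.Fact_unitH0 ∧ U.Fact_gysinDescentB ∧ U.HC_CM ∧
      ¬ U.Fact_cup_hodge :=
  ⟨twistUniverse₃, twistUniverse₃_profile⟩

/-- **Census row F5 (with the realisation)**: F5 `Fact_cupAssoc` is NOT derivable from the other nine binders of
`COR_CM_of_descentFactsB₄` — there is a universe satisfying `ModelAxioms`, `RealisationExistsFace`, N1, N2, F4,
`Fact_dimProd`, F-H0, F7d-B (and N3, N4, `HC_CM`) in which F5 fails. -/
theorem exists_realised_all_but_cupAssoc :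
    ∃ U : Universe, U.ModelAxioms ∧ U.RealisationExistsFace ∧ U.Fact_cupExterior ∧ U.Fact_cup_hodge ∧ U.Fact_pull_H0 ∧
      U.Fact_hodge_F0 ∧ U.Fact_cupAlg ∧ U.Fact_dimProd ∧ U.Fact_unitH0 ∧ U.Fact_gysinDescentB ∧ U.HC_CM ∧
      ¬ U.Fact_cupAssoc :=
  ⟨cupUniverse₃, cupUniverse₃_profile⟩

/-- N2 takes both truth values among realised models of the other nine binders. -/
theorem cup_hodge_independent_realised :
    (∃ U : Universe, U.ModelAxioms ∧ U.RealisationExistsFace ∧ U.Fact_cupExterior ∧ U.Fact_cupAlg ∧ U.Fact_cupAssoc ∧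
        U.Fact_dimProd ∧ U.Fact_unitH0 ∧ U.Fact_gysinDescentB ∧ U.Fact_cup_hodge) ∧
      (∃ U : Universe, U.ModelAxioms ∧ U.RealisationExistsFace ∧ U.Fact_cupExterior ∧ U.Fact_cupAlg ∧ U.Fact_cupAssoc ∧
        U.Fact_dimProd ∧ U.Fact_unitH0 ∧ U.Fact_gysinDescentB ∧ ¬ U.Fact_cup_hodge) := by
  refine ⟨⟨toyUniverse₃ 1 4, ?_⟩, ?_⟩
  · obtain ⟨M, hR, hN1, hN2, h4, h5, hu, hb, hd⟩ := toyUniverse₃_descentFactsB₄_all 1 4 le_rfl (by norm_num)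
    exact ⟨M, hR, hN1, h4, h5, hd, hu, hb, hN2⟩
  · obtain ⟨M, hR, hN1, -, -, h4, h5, hd, hu, hb, -, hno⟩ := twistUniverse₃_profile
    exact ⟨twistUniverse₃, M, hR, hN1, h4, h5, hd, hu, hb, hno⟩

/-- F5 takes both truth values among realised models of the other nine binders. -/
theorem cupAssoc_independent_realised :
    (∃ U : Universe, U.ModelAxioms ∧ U.RealisationExistsFace ∧ U.Fact_cupExterior ∧ U.Fact_cup_hodge ∧ U.Fact_cupAlg ∧
        U.Fact_dimProd ∧ U.Fact_unitH0 ∧ U.Fact_gysinDescentB ∧ U.Fact_cupAssoc) ∧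
      (∃ U : Universe, U.ModelAxioms ∧ U.RealisationExistsFace ∧ U.Fact_cupExterior ∧ U.Fact_cup_hodge ∧ U.Fact_cupAlg ∧
        U.Fact_dimProd ∧ U.Fact_unitH0 ∧ U.Fact_gysinDescentB ∧ ¬ U.Fact_cupAssoc) := by
  refine ⟨⟨toyUniverse₃ 1 4, ?_⟩, ?_⟩
  · obtain ⟨M, hR, hN1, hN2, h4, h5, hu, hb, hd⟩ := toyUniverse₃_descentFactsB₄_all 1 4 le_rfl (by norm_num)
    exact ⟨M, hR, hN1, hN2, h4, hd, hu, hb, h5⟩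
  · obtain ⟨M, hR, hN1, hN2, -, -, h4, hd, hu, hb, -, hno⟩ := cupUniverse₃_profile
    exact ⟨cupUniverse₃, M, hR, hN1, hN2, h4, hd, hu, hb, hno⟩

/-- The same two rows as non-derivability statements over the binder list of `COR_CM_of_descentFactsB₄`. -/
theorem not_cup_hodge_of_others :
    ¬ ∀ U : Universe, U.ModelAxioms → U.RealisationExistsFace → U.Fact_cupExterior → U.Fact_cupAlg → U.Fact_cupAssoc →
      U.Fact_unitH0 → U.Fact_gysinDescentB → U.Fact_dimProd → U.Fact_cup_hodge := by
  intro h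
  obtain ⟨M, hR, hN1, -, -, h4, h5, hd, hu, hb, -, hno⟩ := twistUniverse₃_profile
  exact hno (h _ M hR hN1 h4 h5 hu hb hd)

/-- (Ported verbatim from the HodgeCMPerL package; no docstring in the source.) -/
theorem not_cupAssoc_of_others :
    ¬ ∀ U : Universe, U.ModelAxioms → U.RealisationExistsFace → U.Fact_cupExterior → U.Fact_cup_hodge → U.Fact_cupAlg →
      U.Fact_unitH0 → U.Fact_gysinDescentB → U.Fact_dimProd → U.Fact_cupAssoc := by
  intro h
  obtain ⟨M, hR, hN1, hN2, -, -, h4, hd, hu, hb, -, hno⟩ := cupUniverse₃_profile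
  exact hno (h _ M hR hN1 hN2 h4 hu hb hd)

end ToyG2

end HodgeCM

end
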